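import Mathlib
import Summits.Ventures.PercRepro2.LeafRowPendantRootSOPA
import Summits.Ventures.PercRepro2.LeafRowPendantRootB

/-!
# The signs of `crossBso` and `marginso`, and the degree-one-root contraction of row (LEAF-½)
modulo the two mirror pieces (blind cell PercRepro2, p5 g30; `proofs/P5-OEDGE.md` §40)

* **`crossBso ≥ 0`** (`crossBso_nonneg`): `crossBso = 2Z·crossBfo + P(Q,vH,oH)·S_v − (P(Q,oH) − P(Q,vH,oH))·S_{¬v}`
  with the slacks `S_v = π_b P(Q,vH) − P(Q,vH,bL) ≥ 0`, `S_{¬v} = π_b P(Q,v∉K) − P(Q,v∉K,bL)`, and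
  `P(Q, v ∉ K)·crossBfo ≥ (P(Q,oH) − P(Q,vH,oH))·S_{¬v}` is the positive association of `C(a₂)`
  under the avoidance of `{a₁, v}` (`bhk_univ_avoid` with `F₁ = 1[o ∈ ·]`, `F₂ = π_b − g_b`;
  `pa_bound_B`), `P(Q, v ∉ K) ≤ Z`, `crossBfo ≥ 0`;
* **`marginso ≥ 0`** (`marginso_nonneg`): every factor is theorem-signed (`anticov_nonneg_of_cross`,
  `mU_le_Q`, `slack_nonneg`);
* **`B2h_nonneg_pendant_root_of_mirror`**: `0 ≤ crossA′so + crossB′so` at the open pin gives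
  `0 ≤ B2h` (with `crossAso_nonneg` of `LeafRowPendantRootSOPA`), and
  **`LeafRow_pendant_root_of_mirror`**: the row at the contraction `a₂ := z` and
  `0 ≤ crossA′so + crossB′so` give the row at the pendant instance, every weight of the root edge.

What remains of the pendant-root class is the sign of the two MIRROR pieces `crossA′so + crossB′so`
(census: each ≥ 0 on 282 / 282 corner-weight instances and 300 of p5 g29; nothing here claims it).
Own work; standard axioms.
-/

namespace Summit.Ventures.PercRepro2

open UnionCluster CovForm CovForm.FirstOrder LeafStep LeafHalfCross LeafRowEdgeCubic
  LeafRowFirstOrderA LeafRowPendantRootFO LeafRowPendantRootSO LeafRowPendantRootSOPA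

namespace LeafRowPendantRootSOSign

section CrossB

variable {V : Type*} {E : Type*} [Fintype E] [DecidableEq E] [Fintype V] [DecidableEq V]
  {R : Type*} [Field R] [LinearOrder R] [IsStrictOrderedRing R]
variable (q : E → R) (ends : E → Sym2 V)

omit [Fintype V] [LinearOrder R] [IsStrictOrderedRing R] in
/-- `g_𝓥(K)·1[a₂ ↮ {a₁} ∪ X] = g_𝓥(K)·1[a₂ ↮ X]` (`g_𝓥` already vanishes when `a₁ ∈ K`). -/
lemma outsideProb_mul_indicator_insert (a₁ a₂ : V) (X : Finset V) (𝓥 : Set (Set V)) (ω : Config E) :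
    outsideProb q ends a₁ 𝓥 (cluster ends ω a₂) *
        (avoidAll ends a₂ (insert a₁ X)).indicator (1 : Config E → R) ω =
      outsideProb q ends a₁ 𝓥 (cluster ends ω a₂) * (avoidAll ends a₂ X).indicator (1 : Config E → R) ω := by
  by_cases ha : a₁ ∈ cluster ends ω a₂
  · rw [outsideProb_apply_of_mem q _ ha, zero_mul, zero_mul]
  · by_cases hX : ω ∈ avoidAll ends a₂ X
    · have hm : ω ∈ avoidAll ends a₂ (insert a₁ X) := mem_avoidAll_insert_iff.2 ⟨ha, hX⟩
      rw [Set.indicator_of_mem hm, Set.indicator_of_mem hX]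
    · have hm : ω ∉ avoidAll ends a₂ (insert a₁ X) := fun h => hX (mem_avoidAll_insert_iff.1 h).2
      rw [Set.indicator_of_notMem hm, Set.indicator_of_notMem hX]

omit [LinearOrder R] [IsStrictOrderedRing R] in
/-- **Tower identity under the avoidance of `{a₁} ∪ X`**:
`E[1_𝓤(K)·g_𝓥(K)·1[a₂ ↮ {a₁} ∪ X]] = P(C(a₂) ∈ 𝓤, C(a₁) ∈ 𝓥, a₂ ↮ {a₁} ∪ X)`. -/
lemma expect_outside_avoid (a₁ a₂ : V) (X : Finset V) (𝓤 𝓥 : Set (Set V)) :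
    expect q (fun ω => 𝓤.indicator 1 (cluster ends ω a₂) * outsideProb q ends a₁ 𝓥 (cluster ends ω a₂) *
        (avoidAll ends a₂ (insert a₁ X)).indicator (1 : Config E → R) ω) =
      prob q (clusterInEvent ends a₂ 𝓤 ∩ clusterInEvent ends a₁ 𝓥 ∩ avoidAll ends a₂ (insert a₁ X)) := by
  rw [prob_clusterIn_outside_inter_avoid_eq_expect q ends a₂ a₁ X 𝓤 𝓥]
  congr 1
  funext ω
  rw [mul_assoc, outsideProb_mul_indicator_insert, ← mul_assoc]

omit [LinearOrder R] [IsStrictOrderedRing R] in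
/-- `E[1_𝓤(K)·1[a₂ ↮ {a₁} ∪ X]] = P(C(a₂) ∈ 𝓤, a₂ ↮ {a₁} ∪ X)`. -/
lemma expect_indicator_avoid (a₁ a₂ : V) (X : Finset V) (𝓤 : Set (Set V)) :
    expect q (fun ω => 𝓤.indicator 1 (cluster ends ω a₂) *
        (avoidAll ends a₂ (insert a₁ X)).indicator (1 : Config E → R) ω) =
      prob q (clusterInEvent ends a₂ 𝓤 ∩ avoidAll ends a₂ (insert a₁ X)) := by
  have h := expect_outside_avoid q ends a₁ a₂ X 𝓤 Set.univ
  rw [clusterInEvent_univ, Set.inter_univ] at h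
  rw [← h]
  congr 1
  funext ω
  by_cases hm : ω ∈ avoidAll ends a₂ (insert a₁ X)
  · have ha : a₁ ∉ cluster ends ω a₂ := (mem_avoidAll_insert_iff.1 hm).1
    rw [outsideProb_apply_of_notMem q _ ha, delClusterProb_univ, mul_one]
  · rw [Set.indicator_of_notMem hm, mul_zero, mul_zero]

/-- **Positive association under the avoidance of `{a₁, v}`**:
`(P(Q,oH) − P(Q,vH,oH))·S_{¬v} ≤ (Z − P(Q,vH))·crossBfo` with the slack
`S_{¬v} = π_b·(Z − P(Q,vH)) − (P(Q,bL) − P(Q,vH,bL))`. -/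
lemma pa_bound_B (hq : IsProbVec q) (o a₁ a₂ v b : V) :
    (prob q (avoidAll ends a₂ {a₁} ∩ connEvent ends a₂ o) -
        prob q (avoidAll ends a₂ {a₁} ∩ (connEvent ends a₂ v ∩ connEvent ends a₂ o))) *
      (prob q (connEvent ends a₁ b) *
          (prob q (avoidAll ends a₂ {a₁}) - prob q (avoidAll ends a₂ {a₁} ∩ connEvent ends a₂ v)) -
        (prob q (avoidAll ends a₂ {a₁} ∩ connEvent ends a₁ b) -
          prob q (avoidAll ends a₂ {a₁} ∩ (connEvent ends a₂ v ∩ connEvent ends a₁ b)))) ≤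
    (prob q (avoidAll ends a₂ {a₁}) - prob q (avoidAll ends a₂ {a₁} ∩ connEvent ends a₂ v)) *
      crossBfo q ends o a₁ a₂ v b := by
  have key := bhk_univ_avoid q hq ends a₂ {a₁, v} (indicator_mem_mono (R := R) o)
    (slackFun_mono q ends hq a₁ b) (indicator_mem_nonneg o) (slackFun_nonneg q ends hq a₁ b)
  beta_reduce at key
  have E1 : expect q (fun ω => {W : Set V | o ∈ W}.indicator 1 (cluster ends ω a₂) *
      (avoidAll ends a₂ {a₁, v}).indicator (1 : Config E → R) ω) =
      prob q (avoidAll ends a₂ {a₁} ∩ connEvent ends a₂ o) -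
        prob q (avoidAll ends a₂ {a₁} ∩ (connEvent ends a₂ v ∩ connEvent ends a₂ o)) := by
    rw [expect_indicator_avoid, ← connEvent_eq_clusterInEvent, prob_inter_avoidAll_pair]
  have E2 : expect q (fun ω =>
      (prob q (connEvent ends a₁ b) - outsideProb q ends a₁ {W | b ∈ W} (cluster ends ω a₂)) *
      (avoidAll ends a₂ {a₁, v}).indicator (1 : Config E → R) ω) =
      prob q (connEvent ends a₁ b) *
          (prob q (avoidAll ends a₂ {a₁}) - prob q (avoidAll ends a₂ {a₁} ∩ connEvent ends a₂ v)) -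
        (prob q (avoidAll ends a₂ {a₁} ∩ connEvent ends a₁ b) -
          prob q (avoidAll ends a₂ {a₁} ∩ (connEvent ends a₂ v ∩ connEvent ends a₁ b))) := by
    have h1 := expect_indicator_avoid q ends a₁ a₂ {v} Set.univ
    rw [clusterInEvent_univ, Set.univ_inter, prob_avoidAll_pair] at h1
    have h2 := expect_outside_avoid q ends a₁ a₂ {v} Set.univ {W | b ∈ W}
    rw [clusterInEvent_univ, Set.univ_inter, ← connEvent_eq_clusterInEvent,
      prob_inter_avoidAll_pair] at h2
    rw [← h1, ← h2, ← expect_const_mul, ← expect_sub]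
    congr 1
    funext ω
    simp only [Pi.sub_apply, Set.indicator_univ, Pi.one_apply, one_mul]
    ring
  have E3 : expect q (fun ω => {W : Set V | o ∈ W}.indicator 1 (cluster ends ω a₂) *
      (prob q (connEvent ends a₁ b) - outsideProb q ends a₁ {W | b ∈ W} (cluster ends ω a₂)) *
      (avoidAll ends a₂ {a₁, v}).indicator (1 : Config E → R) ω) =
      prob q (connEvent ends a₁ b) *
          (prob q (avoidAll ends a₂ {a₁} ∩ connEvent ends a₂ o) -
            prob q (avoidAll ends a₂ {a₁} ∩ (connEvent ends a₂ v ∩ connEvent ends a₂ o))) -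
        (prob q (avoidAll ends a₂ {a₁} ∩ (connEvent ends a₂ o ∩ connEvent ends a₁ b)) -
          prob q (avoidAll ends a₂ {a₁} ∩ (connEvent ends a₂ v ∩ (connEvent ends a₂ o ∩ connEvent ends a₁ b)))) := by
    have h1 := expect_indicator_avoid q ends a₁ a₂ {v} {W | o ∈ W}
    rw [← connEvent_eq_clusterInEvent, prob_inter_avoidAll_pair] at h1
    have h2 := expect_outside_avoid q ends a₁ a₂ {v} {W | o ∈ W} {W | b ∈ W}
    rw [← connEvent_eq_clusterInEvent, ← connEvent_eq_clusterInEvent, prob_inter_avoidAll_pair] at h2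
    rw [← h1, ← h2, ← expect_const_mul, ← expect_sub]
    congr 1
    funext ω
    simp only [Pi.sub_apply]
    ring
  rw [E1, E2, E3, prob_avoidAll_pair] at key
  have ident : crossBfo q ends o a₁ a₂ v b =
      prob q (connEvent ends a₁ b) *
          (prob q (avoidAll ends a₂ {a₁} ∩ connEvent ends a₂ o) -
            prob q (avoidAll ends a₂ {a₁} ∩ (connEvent ends a₂ v ∩ connEvent ends a₂ o))) -
        (prob q (avoidAll ends a₂ {a₁} ∩ (connEvent ends a₂ o ∩ connEvent ends a₁ b)) -
          prob q (avoidAll ends a₂ {a₁} ∩ (connEvent ends a₂ v ∩ (connEvent ends a₂ o ∩ connEvent ends a₁ b)))) := by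
    unfold crossBfo
    ring
  rw [ident]
  linarith

/-- **THEOREM: `crossBso ≥ 0`** — `crossBso = 2Z·crossBfo + P(Q,vH,oH)·S_v − (P(Q,oH) − P(Q,vH,oH))·S_{¬v}`
with `crossBfo ≥ 0` (`crossBfo_nonneg`), `S_v ≥ 0` (`slack_nonneg`) and the positive-association
bound `pa_bound_B`. -/
theorem crossBso_nonneg (hq : IsProbVec q) (o a₁ a₂ v b : V) :
    0 ≤ crossBso q ends o a₁ a₂ v b := by
  have hpa := pa_bound_B q ends hq o a₁ a₂ v b
  have hB := crossBfo_nonneg q ends hq o a₁ a₂ v b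
  have hSv := slack_nonneg q ends hq a₁ a₂ b {W | v ∈ W}
  rw [← connEvent_eq_clusterInEvent] at hSv
  have hvH := prob_nonneg hq (avoidAll ends a₂ {a₁} ∩ connEvent ends a₂ v)
  have hvHoH := prob_nonneg hq (avoidAll ends a₂ {a₁} ∩ (connEvent ends a₂ v ∩ connEvent ends a₂ o))
  have key : crossBso q ends o a₁ a₂ v b =
      2 * (prob q (avoidAll ends a₂ {a₁}) * crossBfo q ends o a₁ a₂ v b) +
        prob q (avoidAll ends a₂ {a₁} ∩ (connEvent ends a₂ v ∩ connEvent ends a₂ o)) *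
          (prob q (connEvent ends a₁ b) * prob q (avoidAll ends a₂ {a₁} ∩ connEvent ends a₂ v) -
            prob q (avoidAll ends a₂ {a₁} ∩ (connEvent ends a₂ v ∩ connEvent ends a₁ b))) -
        (prob q (avoidAll ends a₂ {a₁} ∩ connEvent ends a₂ o) -
            prob q (avoidAll ends a₂ {a₁} ∩ (connEvent ends a₂ v ∩ connEvent ends a₂ o))) *
          (prob q (connEvent ends a₁ b) *
              (prob q (avoidAll ends a₂ {a₁}) - prob q (avoidAll ends a₂ {a₁} ∩ connEvent ends a₂ v)) -
            (prob q (avoidAll ends a₂ {a₁} ∩ connEvent ends a₁ b) -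
              prob q (avoidAll ends a₂ {a₁} ∩ (connEvent ends a₂ v ∩ connEvent ends a₁ b)))) := by
    unfold crossBso crossBfo
    ring
  rw [key]
  have h1 : 0 ≤ prob q (avoidAll ends a₂ {a₁} ∩ (connEvent ends a₂ v ∩ connEvent ends a₂ o)) *
      (prob q (connEvent ends a₁ b) * prob q (avoidAll ends a₂ {a₁} ∩ connEvent ends a₂ v) -
        prob q (avoidAll ends a₂ {a₁} ∩ (connEvent ends a₂ v ∩ connEvent ends a₁ b))) :=
    mul_nonneg hvHoH (by linarith)
  have h2 : (prob q (avoidAll ends a₂ {a₁}) - prob q (avoidAll ends a₂ {a₁} ∩ connEvent ends a₂ v)) *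
      crossBfo q ends o a₁ a₂ v b ≤ prob q (avoidAll ends a₂ {a₁}) * crossBfo q ends o a₁ a₂ v b := by
    nlinarith [mul_nonneg hvH hB]
  nlinarith [hpa, h1, h2, mul_nonneg (prob_nonneg hq (avoidAll ends a₂ {a₁})) hB]

end CrossB

section Margin

variable {V : Type*} {E : Type*} [Fintype E] [DecidableEq E] [Fintype V] [DecidableEq V]
  {R : Type*} [Field R] [LinearOrder R] [IsStrictOrderedRing R]
variable (q : E → R) (ends : E → Sym2 V)

/-- **THEOREM: `marginso ≥ 0`** — `(1 − π_v) ≥ 0`, the two anticovariances (BHK06 1.4,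
`anticov_nonneg_of_cross`), `P(Q, v ∉ U) ≥ 0` (`mU_le_Q`) and the two monotonicity slacks
(`slack_nonneg`). -/
theorem marginso_nonneg (hq : IsProbVec q) (o a₁ a₂ v b : V) :
    0 ≤ marginso q ends o a₁ a₂ v b := by
  unfold marginso
  have hv := prob_le_one hq (connEvent ends a₁ v)
  have hA1 := anticov_nonneg_of_cross' q ends hq a₁ a₂ o b
  have hA2 := anticov_nonneg_of_cross q ends hq a₁ a₂ o b
  unfold anticov at hA1 hA2
  have hm := mU_le_Q q ends hq a₁ a₂ v
  unfold mU at hm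
  have h1 := slack_nonneg q ends hq a₁ a₂ b {W | o ∈ W}
  have h2 := slack_nonneg q ends hq a₁ a₂ o {W | b ∈ W}
  rw [← connEvent_eq_clusterInEvent] at h1 h2
  have e2 : avoidAll ends a₂ {a₁} ∩ (connEvent ends a₂ b ∩ connEvent ends a₁ o) =
      avoidAll ends a₂ {a₁} ∩ (connEvent ends a₁ o ∩ connEvent ends a₂ b) := by
    rw [Set.inter_comm (connEvent ends a₂ b)]
  rw [e2] at h2
  exact add_nonneg (mul_nonneg (by linarith) (by linarith)) (mul_nonneg (by linarith) (by linarith))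

end Margin

section Assembly

variable {V : Type*} {E : Type*} [Fintype E] [DecidableEq E] [Fintype V] [DecidableEq V]
  {R : Type*} [Field R] [LinearOrder R] [IsStrictOrderedRing R]
variable {ends : E → Sym2 V} {p : E → R} {e : E} {a₂ z : V}

/-- **`B2h ≥ 0` at a pendant root, given the two mirror pieces**: the three other second-order
pieces are nonnegative outright (`marginso_nonneg`, `crossAso_nonneg`, `crossBso_nonneg`), so
`0 ≤ crossA′so + crossB′so` at the open pin gives `0 ≤ B2h`. -/
theorem B2h_nonneg_pendant_root_of_mirror (hp : IsProbVec p) (he : p e ≠ 1)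
    (hleaf : ∀ f, a₂ ∈ ends f → f = e) (hends : ends e = s(a₂, z)) {o a₁ v b : V}
    (ho : o ≠ a₂) (h1 : a₁ ≠ a₂) (hv : v ≠ a₂) (hb : b ≠ a₂)
    (hAB : 0 ≤ crossA'so (Function.update p e 1) ends o a₁ a₂ v b +
      crossB'so (Function.update p e 1) ends o a₁ a₂ v b) :
    0 ≤ B2h p ends o a₁ a₂ v b e := by
  rw [B2h_eq_so he hleaf hends ho h1 hv hb]
  have hq : IsProbVec (Function.update p e 1) := hp.update e zero_le_one le_rfl
  have hA := crossAso_nonneg (Function.update p e 1) ends hq o a₁ a₂ v b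
  have hM := marginso_nonneg (Function.update p e 1) ends hq o a₁ a₂ v b
  have hB := crossBso_nonneg (Function.update p e 1) ends hq o a₁ a₂ v b
  linarith

/-- **The degree-one-root contraction of row (LEAF-½) modulo the two mirror pieces**: the row at
the contraction `a₂ := z` and `0 ≤ crossA′so + crossB′so` at the open pin give the row at the
pendant instance, for every weight of the root edge (`LeafRowPendantRootB.LeafRow_pendant_root_of_B2h`). -/
theorem LeafRow_pendant_root_of_mirror (hp : IsProbVec p) (hleaf : ∀ f, a₂ ∈ ends f → f = e)
    (hends : ends e = s(a₂, z)) {o a₁ v b : V} (ho : o ≠ a₂) (h1 : a₁ ≠ a₂) (hv : v ≠ a₂) (hb : b ≠ a₂)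
    (hrow : LeafRow (Function.update p e 1) ends o a₁ a₂ v b)
    (hAB : 0 ≤ crossA'so (Function.update p e 1) ends o a₁ a₂ v b +
      crossB'so (Function.update p e 1) ends o a₁ a₂ v b) :
    LeafRow p ends o a₁ a₂ v b := by
  by_cases he : p e = 1
  · rwa [Function.update_eq_self_iff.2 he.symm] at hrow
  · exact LeafRowPendantRootB.LeafRow_pendant_root_of_B2h hp hleaf hends ho h1 hv hb hrow
      (B2h_nonneg_pendant_root_of_mirror hp he hleaf hends ho h1 hv hb hAB)

end Assembly

end LeafRowPendantRootSOSign

end Summit.Ventures.PercRepro2
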